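import Summits.KontsevichZagierPeriods.KontsevichZagierPeriods.Theorems.RootDecompRationalCubeDichotomyRankDescentP19

/-! # `RootDecompRationalCubeDichotomyRankDescentP20` — part 6/9 of the mechanical ≤400-line split of `RankDescent_delta_v12_to_v14h_P15plus.lean` (sha256 311877f354eea7b0…)
Source: decomp-kz lens-2 g15 RankDescent_delta_v12_to_v14h_P15plus.lean @311877f3 (critic CLEARED g7-6 l.1400: 26322 ⟺ LetterDegenerateKernel, GenericKernel THEOREM); --supports stmt-KontsevichZagierPeriods-26322.
Split by census-1 g10 `gen/splitlean.py`: scopes re-opened with their `open`/`variable`/`set_option` context; mathematics and declaration order unchanged. -/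

noncomputable section
open MeasureTheory Set MvPolynomial
open Literature.NumberTheory.Transcendental
open Literature.NumberTheory.Transcendental.KZ
namespace Summit.KontsevichZagierPeriods.RootDecompRationalCubeDichotomy.Rung26322.RankDescent
variable {M : ℕ}
section LetterCriterion
variable {k : ℕ}
section TwoPointInstance
variable {n : ℕ} (q₁ q₂ : ℚ) (h₁ : 0 < q₁ ∨ q₁ < -1) (h₂ : 0 < q₂ ∨ q₂ < -1)

include h₁ h₂ in
/-- **The two-point system is letter-generic at level `k+1`** under `TwoPointNew k`: TWO letters
`(q₂+u)/((q₁+u)(q₂+u)) = 1/(q₁+u)` and `1/(q₂+u)`. [folklore] -/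
theorem genAt_twoSys {k : ℕ} (hne : q₁ ≠ q₂) (hN : TwoPointNew q₁ q₂ h₁ h₂ k) (hk : k + 1 ≤ n) :
    GenAt (twoSys q₁ q₂ n) k := by
  classical
  refine ⟨Bool, fun _ => fhQ (k + 1) q₁ * fhQ (k + 1) q₂,
    fun b => cond b (fhQ (k + 1) q₂) (fhQ (k + 1) q₁), fun _ => Or.inl ⟨hk, rfl⟩, ?_, ?_⟩
  · rintro F (⟨-, rfl⟩ | ⟨u, hu, rfl⟩) P
    · refine ⟨Finsupp.single true ((q₂ - q₁)⁻¹ * diagAltm q₁ P)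
          + Finsupp.single false (-((q₂ - q₁)⁻¹ * diagAltm q₂ P)), fun _ _ => rfl, ?_⟩
      rw [Finsupp.sum_add_index' (fun _ => by rw [C_0, zero_mul]) (fun _ _ _ => by rw [map_add, add_mul]),
        Finsupp.sum_single_index (by rw [C_0, zero_mul]),
        Finsupp.sum_single_index (by rw [C_0, zero_mul])]
      exact span_two q₁ q₂ hne P
    · refine ⟨0, fun i hi => by simp at hi, ?_⟩
      rw [Finsupp.sum_zero_index, sub_zero]
      have h := mul_mem_ex0m (C u) (C u⁻¹ * P)
      rwa [← mul_assoc, ← map_mul, mul_inv_cancel₀ hu, map_one, one_mul] at h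
  · intro c hc
    have hvt : cubeVal (k + 1) (fhQ (k + 1) q₂) (fhQ (k + 1) q₁ * fhQ (k + 1) q₂) = letter q₁ h₁ (k + 1) := by
      have : cubeVal (k + 1) (fhQ (k + 1) q₂) (fhQ (k + 1) q₁ * fhQ (k + 1) q₂)
          = (twoR q₁ q₂ h₁ h₂ (k + 1) (fhQ (k + 1) q₂)).rep.value := rfl
      rw [this]
      refine value_eq_of_fn_eq fun x hx => ?_
      rw [RFun.fn_apply, RFun.fn_apply]
      show aeval x (fhQ (k + 1) q₂) / aeval x (fhQ (k + 1) q₁ * fhQ (k + 1) q₂)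
        = aeval x 1 / aeval x (fhQ (k + 1) q₁)
      rw [map_mul, mul_comm, div_mul_eq_div_div, div_self (fhQ_ne_zero_of q₂ h₂ x hx), map_one]
    have hvf : cubeVal (k + 1) (fhQ (k + 1) q₁) (fhQ (k + 1) q₁ * fhQ (k + 1) q₂) = letter q₂ h₂ (k + 1) := by
      have : cubeVal (k + 1) (fhQ (k + 1) q₁) (fhQ (k + 1) q₁ * fhQ (k + 1) q₂)
          = (twoR q₁ q₂ h₁ h₂ (k + 1) (fhQ (k + 1) q₁)).rep.value := rfl
      rw [this]
      refine value_eq_of_fn_eq fun x hx => ?_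
      rw [RFun.fn_apply, RFun.fn_apply]
      show aeval x (fhQ (k + 1) q₁) / aeval x (fhQ (k + 1) q₁ * fhQ (k + 1) q₂)
        = aeval x 1 / aeval x (fhQ (k + 1) q₂)
      rw [map_mul, div_mul_eq_div_div, div_self (fhQ_ne_zero_of q₁ h₁ x hx), map_one]
    have hsum : c.sum (fun i r => (r : ℝ)
        * cubeVal (k + 1) (cond i (fhQ (k + 1) q₂) (fhQ (k + 1) q₁)) (fhQ (k + 1) q₁ * fhQ (k + 1) q₂))
        = ((c true : ℚ) : ℝ) * letter q₁ h₁ (k + 1) + ((c false : ℚ) : ℝ) * letter q₂ h₂ (k + 1) := by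
      rw [Finsupp.sum_fintype _ _ (fun _ => by rw [Rat.cast_zero, zero_mul]), Fintype.sum_bool]
      show ((c true : ℚ) : ℝ) * cubeVal (k + 1) (fhQ (k + 1) q₂) _
          + ((c false : ℚ) : ℝ) * cubeVal (k + 1) (fhQ (k + 1) q₁) _ = _
      rw [hvt, hvf]
    rw [hsum] at hc
    obtain ⟨ht, hf⟩ := hN (c true) (c false) (VSpan_twoSys_le q₁ q₂ h₁ h₂ hne k hc)
    ext b
    cases b
    · exact hf
    · exact ht

include h₁ h₂ in
/-- **The two-point product `(q₁+u)(q₂+u)` is letter-generic** as soon as, at each level `2 … n`, its two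
top letters are jointly new. [folklore] -/
theorem isGeneric_two (hne : q₁ ≠ q₂) (hN : ∀ k, k + 2 ≤ n → TwoPointNew q₁ q₂ h₁ h₂ (k + 1)) :
    IsGeneric (fhQ n q₁ * fhQ n q₂) :=
  ⟨twoSys q₁ q₂ n, zeroFree_twoSys q₁ q₂ h₁ h₂, faceClosed_twoSys q₁ q₂ h₁ h₂, Or.inl ⟨le_rfl, rfl⟩,
    fun k hk => genAt_twoSys q₁ q₂ h₁ h₂ hne (hN k hk) hk⟩

/-- **DECIDED (mod the two-point input): `[ [0,1]^n, P/((q₁+u)(q₂+u)) ]` of value `0` is `≡ 0`, every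
numerator `P`, `N = 0`** — a full-rank, non-exact, non-tower class of crux 26322 in every dimension,
by THEOREM U. (cite arXiv:2010.09167, Corollary 1) -/
theorem two_decided (hne : q₁ ≠ q₂) (hN : ∀ k, k + 2 ≤ n → TwoPointNew q₁ q₂ h₁ h₂ (k + 1))
    (P : MvPolynomial (Fin n) ℚ) (h0 : (twoR q₁ q₂ h₁ h₂ n P).rep.value = 0) :
    KZ.of (twoR q₁ q₂ h₁ h₂ n P).rep ∈ KZ.relations :=
  rep_mem_relations_of_generic (twoSys q₁ q₂ n) (zeroFree_twoSys q₁ q₂ h₁ h₂)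
    (faceClosed_twoSys q₁ q₂ h₁ h₂) (fun k hk => genAt_twoSys q₁ q₂ h₁ h₂ hne (hN k hk) hk)
    (twoR q₁ q₂ h₁ h₂ n P) (Or.inl ⟨le_rfl, rfl⟩) h0

/-- The dimension-2 class `Q = (q₁ + xy)(q₂ + xy)`, decided from the joint newness of the two
dilogarithms `Li₂(−1/q₁), Li₂(−1/q₂)` over `ℚ + ℚ·log(1+1/q₁) + ℚ·log(1+1/q₂)` alone. (cite arXiv:2010.09167, Corollary 1) -/
theorem two_decided_dim_two (hne : q₁ ≠ q₂) (hN : TwoPointNew q₁ q₂ h₁ h₂ 1)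
    (P : MvPolynomial (Fin 2) ℚ) (h0 : (twoR q₁ q₂ h₁ h₂ 2 P).rep.value = 0) :
    KZ.of (twoR q₁ q₂ h₁ h₂ 2 P).rep ∈ KZ.relations :=
  two_decided q₁ q₂ h₁ h₂ (n := 2) hne (fun k hk => by obtain rfl : k = 0 := (by omega); exact hN) P h0

/-- … and crux 26322's own shape for this class (any `IntegralRep` with the cube domain and this
integrand). (cite arXiv:2010.09167, Corollary 1) -/
theorem two_single (hne : q₁ ≠ q₂) (hN : ∀ k, k + 2 ≤ n → TwoPointNew q₁ q₂ h₁ h₂ (k + 1))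
    (q : IntegralRep n) (P : MvPolynomial (Fin n) ℚ)
    (hd : q.domain = Set.pi Set.univ (fun _ : Fin n => Set.Icc (0:ℝ) 1))
    (hf : ∀ z ∈ Set.pi Set.univ (fun _ : Fin n => Set.Icc (0:ℝ) 1),
      q.integrand z = MvPolynomial.aeval z P / MvPolynomial.aeval z (fhQ n q₁ * fhQ n q₂))
    (h0 : q.value = 0) : of q ∈ relations :=
  generic_mem_relations q P _ (isGeneric_two q₁ q₂ h₁ h₂ hne hN) hd
    (fun z hz => two_ne_zero_cube q₁ q₂ h₁ h₂ z (by rwa [KZ.cube_eq_pi])) hf h0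

end TwoPointInstance

section SpecialResident

/-! ### §18b — the torus-weight-zero projection and the residue obstruction to simple-pole exactness -/

/-- Summand of the weight-zero (diagonal) projection `ℚ[x,y] → ℚ[u]`, `x^a y^b ↦ [a = b]·u^a`. (folklore) -/
def dprojFn (d : Fin 2 →₀ ℕ) (a : ℚ) : Polynomial ℚ :=
  if d 0 = d 1 then Polynomial.monomial (d 0) a else 0

/-- **The diagonal projection** `dproj (Σ m_{ab} x^a y^b) = Σ_a m_{aa} u^a` (the weight-`0` part for the
torus action `(x,y) ↦ (λx, λ⁻¹y)`, read in the invariant `u = xy`). (folklore) -/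
def dproj (M : MvPolynomial (Fin 2) ℚ) : Polynomial ℚ := (AddMonoidAlgebra.coeff M).sum dprojFn

/-- Auxiliary step `dproj_monomial` (§18b): dproj monomial. [bookkeeping] -/
theorem dproj_monomial (d : Fin 2 →₀ ℕ) (a : ℚ) : dproj (monomial d a) = dprojFn d a :=
  sum_monomial_eq (by simp [dprojFn])

/-- Auxiliary step `dproj_zero` (§18b): dproj zero. [bookkeeping] -/
theorem dproj_zero : dproj 0 = 0 := by
  rw [← C_0, ← monomial_zero', dproj_monomial]; simp [dprojFn]

/-- Auxiliary step `dproj_add` (§18b): dproj add. [bookkeeping] -/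
theorem dproj_add (P P' : MvPolynomial (Fin 2) ℚ) : dproj (P + P') = dproj P + dproj P' := by
  unfold dproj
  rw [AddMonoidAlgebra.coeff_add]
  exact Finsupp.sum_add_index' (fun d => by simp [dprojFn]) (fun d b₁ b₂ => by
    unfold dprojFn; split_ifs <;> simp)

/-- `dproj` as an additive homomorphism. (folklore) -/
def dprojHom : MvPolynomial (Fin 2) ℚ →+ Polynomial ℚ where
  toFun := dproj
  map_zero' := dproj_zero
  map_add' := dproj_add

/-- Auxiliary step `dprojHom_apply` (§18b): dproj Hom apply. [bookkeeping] -/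
theorem dprojHom_apply (M : MvPolynomial (Fin 2) ℚ) : dprojHom M = dproj M := rfl

/-- Auxiliary step `dproj_sub` (§18b): dproj sub. [bookkeeping] -/
theorem dproj_sub (P P' : MvPolynomial (Fin 2) ℚ) : dproj (P - P') = dproj P - dproj P' := by
  rw [← dprojHom_apply, map_sub, dprojHom_apply, dprojHom_apply]

/-- Auxiliary step `dproj_sum` (§18b): dproj sum. [bookkeeping] -/
theorem dproj_sum {ι : Type*} (s : Finset ι) (f : ι → MvPolynomial (Fin 2) ℚ) :
    dproj (∑ i ∈ s, f i) = ∑ i ∈ s, dproj (f i) := by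
  rw [← dprojHom_apply, map_sum]; rfl

/-- Multiplication by a diagonal monomial `b·u^e` commutes with `dproj`. [folklore] -/
theorem dproj_mul_monomial_diag (M : MvPolynomial (Fin 2) ℚ) (e : ℕ) (b : ℚ) :
    dproj (M * monomial (Finsupp.single 0 e + Finsupp.single 1 e) b) = dproj M * Polynomial.monomial e b := by
  induction M using MvPolynomial.induction_on' with
  | monomial d a =>
    rw [monomial_mul, dproj_monomial, dproj_monomial, dprojFn, dprojFn]
    simp only [Finsupp.add_apply, Finsupp.single_apply, if_true, OfNat.ofNat_ne_one,
      if_false, add_zero, zero_add, one_ne_zero, Fin.zero_eq_one_iff]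
    by_cases h : d 0 = d 1
    · rw [if_pos h, if_pos (by rw [h]), Polynomial.monomial_mul_monomial]
    · rw [if_neg h, if_neg (by intro h'; exact h (by omega)), zero_mul]
  | add p q hp hq => rw [add_mul, dproj_add, dproj_add, hp, hq, add_mul]

/-- The embedding `ℚ[u] → ℚ[x,y]`, `u ↦ xy`. (folklore) -/
def uOf : Polynomial ℚ →ₐ[ℚ] MvPolynomial (Fin 2) ℚ := Polynomial.aeval (X 0 * X 1)

/-- Auxiliary step `uOf_monomial` (§18b): u Of monomial. [bookkeeping] -/
theorem uOf_monomial (e : ℕ) (b : ℚ) :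
    uOf (Polynomial.monomial e b) = monomial (Finsupp.single 0 e + Finsupp.single 1 e) b := by
  rw [uOf, Polynomial.aeval_monomial, mul_pow, X_pow_eq_monomial, X_pow_eq_monomial, monomial_mul, mul_one,
    algebraMap_eq, C_mul_monomial, mul_one]

/-- Auxiliary step `uOf_X_add_C` (§18b): u Of X add C. [bookkeeping] -/
theorem uOf_X_add_C (q : ℚ) : uOf (Polynomial.X + Polynomial.C q) = X 0 * X 1 + C q := by
  rw [uOf, map_add, Polynomial.aeval_X, Polynomial.aeval_C, algebraMap_eq]

/-- `dproj (M · p(xy)) = dproj M · p`. [folklore] -/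
theorem dproj_mul_uOf (M : MvPolynomial (Fin 2) ℚ) (p : Polynomial ℚ) : dproj (M * uOf p) = dproj M * p := by
  induction p using Polynomial.induction_on' with
  | add p q hp hq => rw [map_add, mul_add, dproj_add, hp, hq, mul_add]
  | monomial e b => rw [uOf_monomial, dproj_mul_monomial_diag]

/-- Auxiliary step `dproj_one` (§18b): dproj one. [bookkeeping] -/
theorem dproj_one : dproj 1 = 1 := by
  rw [← C_1, ← monomial_zero', dproj_monomial]; simp [dprojFn]

/-- `dproj (p(xy)) = p`. [folklore] -/
theorem dproj_uOf (p : Polynomial ℚ) : dproj (uOf p) = p := by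
  rw [← one_mul (uOf p), dproj_mul_uOf, dproj_one, one_mul]

/-- `dproj ∘ ∂_x = d/du ∘ dproj ∘ (y·)`. [folklore] -/
theorem dproj_pderiv_zero (G : MvPolynomial (Fin 2) ℚ) :
    dproj (pderiv 0 G) = Polynomial.derivative (dproj (X 1 * G)) := by
  induction G using MvPolynomial.induction_on' with
  | monomial d a =>
    have e0 : (d - Finsupp.single 0 1 : Fin 2 →₀ ℕ) 0 = d 0 - 1 := by simp
    have e1 : (d - Finsupp.single 0 1 : Fin 2 →₀ ℕ) 1 = d 1 := by simp
    have f0 : (Finsupp.single 1 1 + d : Fin 2 →₀ ℕ) 0 = d 0 := by simp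
    have f1 : (Finsupp.single 1 1 + d : Fin 2 →₀ ℕ) 1 = d 1 + 1 := by simp [add_comm]
    rw [pderiv_monomial, dproj_monomial, X, monomial_mul, one_mul, dproj_monomial, dprojFn, dprojFn, e0, e1,
      f0, f1]
    by_cases h0 : d 0 = 0
    · rw [h0, Nat.cast_zero, mul_zero, Polynomial.monomial_zero_right, ite_self, if_neg (by omega),
        Polynomial.derivative_zero]
    · by_cases h : d 0 - 1 = d 1
      · rw [if_pos h, if_pos (by omega), Polynomial.derivative_monomial]
      · rw [if_neg h, if_neg (by omega), Polynomial.derivative_zero]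
  | add p q hp hq => rw [map_add, dproj_add, mul_add, dproj_add, Polynomial.derivative_add, hp, hq]

/-- `dproj ∘ ∂_y = d/du ∘ dproj ∘ (x·)`. [folklore] -/
theorem dproj_pderiv_one (G : MvPolynomial (Fin 2) ℚ) :
    dproj (pderiv 1 G) = Polynomial.derivative (dproj (X 0 * G)) := by
  induction G using MvPolynomial.induction_on' with
  | monomial d a =>
    have e0 : (d - Finsupp.single 1 1 : Fin 2 →₀ ℕ) 0 = d 0 := by simp
    have e1 : (d - Finsupp.single 1 1 : Fin 2 →₀ ℕ) 1 = d 1 - 1 := by simp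
    have f0 : (Finsupp.single 0 1 + d : Fin 2 →₀ ℕ) 0 = d 0 + 1 := by simp [add_comm]
    have f1 : (Finsupp.single 0 1 + d : Fin 2 →₀ ℕ) 1 = d 1 := by simp
    rw [pderiv_monomial, dproj_monomial, X, monomial_mul, one_mul, dproj_monomial, dprojFn, dprojFn, e0, e1,
      f0, f1]
    by_cases h1 : d 1 = 0
    · rw [h1, Nat.cast_zero, mul_zero, Polynomial.monomial_zero_right, ite_self, if_neg (by omega),
        Polynomial.derivative_zero]
    · by_cases h : d 0 = d 1 - 1
      · have hd : d 1 = d 0 + 1 := by omega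
        rw [if_pos h, if_pos (by omega), Polynomial.derivative_monomial, Nat.add_sub_cancel, hd]
      · rw [if_neg h, if_neg (by omega), Polynomial.derivative_zero]
  | add p q hp hq => rw [map_add, dproj_add, mul_add, dproj_add, Polynomial.derivative_add, hp, hq]

/-- Chain rule `∂_x p(xy) = y·p′(xy)`. [folklore] -/
theorem pderiv_zero_uOf (p : Polynomial ℚ) :
    pderiv 0 (uOf p) = X 1 * uOf (Polynomial.derivative p) := by
  induction p using Polynomial.induction_on' with
  | add p q hp hq => rw [map_add, map_add, hp, hq, map_add, map_add, mul_add]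
  | monomial e b =>
    rw [Polynomial.derivative_monomial, uOf_monomial, uOf_monomial, pderiv_monomial, X, monomial_mul, one_mul]
    rcases Nat.eq_zero_or_pos e with he | he
    · subst he; simp
    · have hs : (Finsupp.single 0 e + Finsupp.single 1 e - Finsupp.single 0 1 : Fin 2 →₀ ℕ)
          = Finsupp.single 1 1 + (Finsupp.single 0 (e - 1) + Finsupp.single 1 (e - 1)) := by
        ext i
        fin_cases i
        · simp
        · simp; omega
      have hc : (Finsupp.single 0 e + Finsupp.single 1 e : Fin 2 →₀ ℕ) 0 = e := by simp
      rw [hc, hs]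
/-- Chain rule `∂_y p(xy) = x·p′(xy)`. [folklore] -/
theorem pderiv_one_uOf (p : Polynomial ℚ) :
    pderiv 1 (uOf p) = X 0 * uOf (Polynomial.derivative p) := by
  induction p using Polynomial.induction_on' with
  | add p q hp hq => rw [map_add, map_add, hp, hq, map_add, map_add, mul_add]
  | monomial e b =>
    rw [Polynomial.derivative_monomial, uOf_monomial, uOf_monomial, pderiv_monomial, X, monomial_mul, one_mul]
    rcases Nat.eq_zero_or_pos e with he | he
    · subst he; simp
    · have hs : (Finsupp.single 0 e + Finsupp.single 1 e - Finsupp.single 1 1 : Fin 2 →₀ ℕ)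
          = Finsupp.single 0 1 + (Finsupp.single 0 (e - 1) + Finsupp.single 1 (e - 1)) := by
        ext i
        fin_cases i
        · simp; omega
        · simp
      have hc : (Finsupp.single 0 e + Finsupp.single 1 e : Fin 2 →₀ ℕ) 1 = e := by simp
      rw [hc, hs]

/-- **The diagonal part of a simple-pole exact numerator is a Wronskian**: if `P·Q = Σ_j S_j(G_j)` over
`Q = Q̂(xy)`, then `dproj P · Q̂ = H′·Q̂ − H·Q̂′` in `ℚ[u]` (`H = dproj(y·G_x + x·G_y)`). [folklore] -/
theorem dproj_wronskian_of_mem_ex0m (Qh : Polynomial ℚ) {P : MvPolynomial (Fin 2) ℚ} (hP : P ∈ Ex0m (uOf Qh)) :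
    ∃ H : Polynomial ℚ, dproj P * Qh = Polynomial.derivative H * Qh - H * Polynomial.derivative Qh := by
  obtain ⟨G, hG⟩ := mem_ex0m_iff.mp hP
  refine ⟨dproj (X 1 * G 0) + dproj (X 0 * G 1), ?_⟩
  have key := congrArg dproj hG
  rw [dproj_mul_uOf, Fin.sum_univ_two, dproj_add] at key
  have hx : dproj (exS (uOf Qh) 0 (G 0))
      = Polynomial.derivative (dproj (X 1 * G 0)) * Qh - dproj (X 1 * G 0) * Polynomial.derivative Qh := by
    simp only [exS, Nat.cast_zero, zero_add, map_one, one_mul]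
    rw [dproj_sub, dproj_mul_uOf, dproj_pderiv_zero, pderiv_zero_uOf, ← mul_assoc,
      mul_comm (G 0) (X 1), dproj_mul_uOf]
  have hy : dproj (exS (uOf Qh) 1 (G 1))
      = Polynomial.derivative (dproj (X 0 * G 1)) * Qh - dproj (X 0 * G 1) * Polynomial.derivative Qh := by
    simp only [exS, Nat.cast_zero, zero_add, map_one, one_mul]
    rw [dproj_sub, dproj_mul_uOf, dproj_pderiv_one, pderiv_one_uOf, ← mul_assoc,
      mul_comm (G 1) (X 0), dproj_mul_uOf]
  rw [key, hx, hy, Polynomial.derivative_add]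
  ring

/-- **Wronskian residue lemma** in `ℚ[u]`: `P₀·Q̂ = H′Q̂ − HQ̂′` with `Q̂ = (u + q)·R`, `R(−q) ≠ 0`
forces `P₀(−q) = 0`. [folklore] -/
theorem eval_eq_zero_of_wronskian {P₀ H Qh R : Polynomial ℚ} (q : ℚ)
    (hQ : Qh = (Polynomial.X + Polynomial.C q) * R) (hR : R.eval (-q) ≠ 0)
    (h : P₀ * Qh = Polynomial.derivative H * Qh - H * Polynomial.derivative Qh) : P₀.eval (-q) = 0 := by
  have hlin : (Polynomial.X + Polynomial.C q).eval (-q) = 0 := by simp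
  have hdQ : Polynomial.derivative Qh = R + (Polynomial.X + Polynomial.C q) * Polynomial.derivative R := by
    rw [hQ, Polynomial.derivative_mul]; simp
  have hQ0 : Qh.eval (-q) = 0 := by rw [hQ, Polynomial.eval_mul, hlin, zero_mul]
  have hdQ0 : (Polynomial.derivative Qh).eval (-q) = R.eval (-q) := by
    rw [hdQ, Polynomial.eval_add, Polynomial.eval_mul, hlin, zero_mul, add_zero]
  -- evaluate at `-q`: `H(-q)·R(-q) = 0`
  have h1 : H.eval (-q) * R.eval (-q) = 0 := by
    have e1 := congrArg (Polynomial.eval (-q)) h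
    simp only [Polynomial.eval_mul, Polynomial.eval_sub] at e1
    rw [hQ0, hdQ0] at e1
    linear_combination e1
  have hH0 : H.IsRoot (-q) := by
    rw [Polynomial.IsRoot.def]
    exact (mul_eq_zero.mp h1).resolve_right hR
  obtain ⟨K, hK⟩ : ∃ K, H = (Polynomial.X + Polynomial.C q) * K := by
    refine ⟨H /ₘ (Polynomial.X - Polynomial.C (-q)), ?_⟩
    rw [show Polynomial.X + Polynomial.C q = Polynomial.X - Polynomial.C (-q) by rw [map_neg, sub_neg_eq_add]]
    exact (Polynomial.mul_divByMonic_eq_iff_isRoot.mpr hH0).symm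
  have hdH : Polynomial.derivative H = K + (Polynomial.X + Polynomial.C q) * Polynomial.derivative K := by
    rw [hK, Polynomial.derivative_mul]; simp
  rw [hdQ, hdH] at h
  rw [hQ, hK] at h
  have hne : (Polynomial.X + Polynomial.C q) ≠ 0 := Polynomial.X_add_C_ne_zero q
  have e : (Polynomial.X + Polynomial.C q) * (P₀ * R)
      = (Polynomial.X + Polynomial.C q) * ((Polynomial.X + Polynomial.C q)
          * (Polynomial.derivative K * R - K * Polynomial.derivative R)) := by
    linear_combination h
  have e2 := mul_left_cancel₀ hne e
  have := congrArg (Polynomial.eval (-q)) e2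
  simp only [Polynomial.eval_mul, hlin, zero_mul] at this
  exact (mul_eq_zero.mp this).resolve_right hR

/-- **THE RESIDUE OBSTRUCTION.** Over `Q = Q̂(xy)` with `Q̂ = (u + q)·R`, `R(−q) ≠ 0`, every simple-pole exact
numerator `P ∈ Ex0m Q` has `dproj(P)(−q) = 0` (the Poincaré residue of `P dxdy/Q` along `{xy = −q} ≅ 𝔾_m`,
paired with the class `dt/t`). [folklore] -/
theorem eval_dproj_eq_zero_of_mem_ex0m {Qh R : Polynomial ℚ} (q : ℚ)
    (hQ : Qh = (Polynomial.X + Polynomial.C q) * R) (hR : R.eval (-q) ≠ 0)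
    {P : MvPolynomial (Fin 2) ℚ} (hP : P ∈ Ex0m (uOf Qh)) : (dproj P).eval (-q) = 0 := by
  obtain ⟨H, hH⟩ := dproj_wronskian_of_mem_ex0m Qh hP
  exact eval_eq_zero_of_wronskian q hQ hR hH

/-! ### §18b (continued) — exactness at a generic level, Landen's relation, a certified special resident -/

end SpecialResident
end LetterCriterion
end Summit.KontsevichZagierPeriods.RootDecompRationalCubeDichotomy.Rung26322.RankDescent
end
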